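import Summits.ResolutionOfSingularities.ResolutionOfSingularities.Theorems.PurelyInseparableDim4Straightening
import Summits.ResolutionOfSingularities.ResolutionOfSingularities.Theorems.PurelyInseparableDim4Equimultiple
import Summits.ResolutionOfSingularities.ResolutionOfSingularities.Theorems.PurelyInseparableDim4MohAlong
import Summits.ResolutionOfSingularities.ResolutionOfSingularities.Theorems.PurelyInseparableDim4Scope
import Summits.ResolutionOfSingularities.ResolutionOfSingularities.Theorems.PurelyInseparableDim4ZooCertJ001
import Literature.AlgebraicGeometry.Resolution.OrdZeroBasics
import Literature.RingTheory.MvPolynomial.IdealOfVarsBasics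
import HarnessLib
import HarnessLib.Audit.Tags

/-!
# Purely inseparable four-folds — the TSCHIRNHAUS / W-FRAME MOVE `x_f ↦ x_f + φ(x_{≠f})` and its
# dictionary with the point blow-up (cell `res-dim4-pi`, K2(p) lane, brick (ii) FILE B, part 1)

[OURS · counted 0 · cell `res-dim4-pi` · brick (ii) «Tschirnhaus / W-frame infrastructure», shapes of record
res-dim4-p-1 g2 (2026-08-28 22:28Z), this file res-dim4-p-11 g2 (desk WORDS #79–#81).]  Nothing here proves
K2(p), `NoIsolatedTrap p p` or resolution of singularities in dimension ≥ 4 / characteristic `p`.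

idea-4's CARD I-4-7 (TS) and memo E2-WINDOW (A2)/(A3) re-coordinatise a presented state `(F, r, exc)` by a
Tschirnhaus / W-frame change `y = x_f + φ(u)` of ONE free letter `f` (`φ` a polynomial in the OTHER
letters, `φ(0) = 0`; linear `φ` = the linear W-frame moves, `ord φ ≥ 2` = the Tschirnhaus part), and then
read every later blow-up step in the new frame.  This file types the move and proves the bookkeeping:

* §1 `tsch f φ : K[x] →ₐ[K] K[x]`, `x_f ↦ x_f + φ`, `x_i ↦ x_i` (`i ≠ f`); group law `tsch_comp_tsch`,
  inverse `tsch f (−φ)` (`tsch_comp_tsch_neg`), the automorphism `tschEquiv f φ hφ` (`hφ : f ∉ φ.vars`);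
  polynomials without `x_f` — in particular the boundary monomials `x^r`, `r_f = 0` — are FIXED
  (`tsch_apply_of_not_mem_vars`, `tsch_monomial_of_apply_eq_zero`).
* §2 `ordZero_tsch` (`ord₀` is preserved), `constantCoeff_tsch`.
* §3 THE DICTIONARY WITH THE POINT BLOW-UP (chart `j ≠ f`): with `φ′ := chartTransform 1 univ j φ`
  (`σ_j(φ) = x_j · φ′`), `coordBlowupSubst_comp_tsch : σ_j ∘ tsch f φ = tsch f φ′ ∘ σ_j`,
  `chartTransform_tsch`, `translate_tsch`, and `pointTransform_tsch`: writing
  **`b⁺ := Function.update b f (b f + eval b φ′)`**, **`φ⁺ := translate b φ′ − C (eval b φ′)`**,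
  `pointTransform q univ j b ⟨tsch f φ F, r, exc⟩ = tsch f φ⁺ (pointTransform q univ j b⁺ ⟨F, r, exc⟩)` — the
  translation moves along the contact letter only, by `eval b φ′ = (linear part of φ)(direction j b)`.

Part 2 (`…TschirnhausFrameStep`): `initialForm_tsch_of_two_le` (the Tschirnhaus part `ord₀ φ ≥ 2` is inert
on the initial form), the state-level step `step_F_tsch` / `step_r_tsch` / `step_exc_tsch`, the
admissibility of `φ⁺`, and the correspondence of equimultiple points / `Step0` edges.  What is NOT here:
isolation / `resVertex` / shade invariance of the re-coordinatised state (FILE C, p-1, over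
`…IsolationAutomorphism`), EXISTENCE of the Tschirnhaus `φ` (FILE D), (LEDGER)/(DL) themselves.
bears_on: LADDER-RESOLUTION:D157-DOOR2 (res-dim4-pi · K2(p) · (ii)).  Supports
stmt-ResolutionOfSingularities-16155 (helper).
-/

set_option linter.dupNamespace false -- mandated namespace of this single-conjunct summit

noncomputable section

namespace Summit.ResolutionOfSingularities.ResolutionOfSingularities.Theorems.PIDim4

namespace FrameChange

open MvPolynomial Finset
open Literature.AlgebraicGeometry.Resolution
open Literature.AlgebraicGeometry.Resolution.Hauser2010
open Literature.AlgebraicGeometry.Resolution.HauserPerlega2019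
open Literature.AlgebraicGeometry.Resolution.CentreBlowup
open PointBlowup (translate)

variable {K : Type} [Field K]

/-! ## 1. The move `x_f ↦ x_f + φ` -/

/-- **The Tschirnhaus / W-frame move** on `K[x₁..x₄]`: `x_f ↦ x_f + φ`, the other letters fixed
(idea-4 I-4-7 (TS): `v̄ = x_f + φ(x_{≠f})`; for linear `φ` the linear W-frame changes of E2-WINDOW (A2)).
[cite: Kollar2007, Aside 3.57 (maximal contact / Tschirnhaus for order < char)] [folklore] -/
def tsch (f : Fin 4) (φ : MvPolynomial (Fin 4) K) : MvPolynomial (Fin 4) K →ₐ[K] MvPolynomial (Fin 4) K :=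
  aeval fun i => if i = f then X f + φ else X i

variable {f : Fin 4} {φ : MvPolynomial (Fin 4) K}

/-- `tsch f φ (x_f) = x_f + φ`. [folklore] -/
@[simp] theorem tsch_X_self (f : Fin 4) (φ : MvPolynomial (Fin 4) K) : tsch f φ (X f) = X f + φ := by
  rw [tsch, aeval_X, if_pos rfl]

/-- `tsch f φ (x_i) = x_i` for `i ≠ f`. [folklore] -/
@[simp] theorem tsch_X_of_ne (φ : MvPolynomial (Fin 4) K) {i : Fin 4} (h : i ≠ f) : tsch f φ (X i) = X i := by
  rw [tsch, aeval_X, if_neg h]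

/-- `tsch` is the substitution of its values on the variables. [folklore] -/
theorem tsch_eq_aeval (f : Fin 4) (φ : MvPolynomial (Fin 4) K) :
    tsch f φ = aeval fun i => tsch f φ (X i) :=
  MvPolynomial.algHom_ext fun i => by rw [aeval_X]

/-- `f ∉ ψ.vars` iff no monomial of `ψ` involves `x_f`. [folklore] -/
theorem not_mem_vars_iff (f : Fin 4) (ψ : MvPolynomial (Fin 4) K) :
    f ∉ ψ.vars ↔ ∀ d ∈ ψ.support, d f = 0 := by
  rw [MvPolynomial.mem_vars_iff_mem_support]
  push Not
  refine forall_congr' fun d => forall_congr' fun _ => ?_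
  rw [Finsupp.mem_support_iff, not_not]

/-- **Polynomials not involving `x_f` are fixed** by `tsch f φ`. [folklore] -/
theorem tsch_apply_of_not_mem_vars (φ : MvPolynomial (Fin 4) K) {ψ : MvPolynomial (Fin 4) K}
    (hψ : f ∉ ψ.vars) : tsch f φ ψ = ψ := by
  have h := MvPolynomial.hom_congr_vars (f₁ := (tsch f φ : MvPolynomial (Fin 4) K →+* MvPolynomial (Fin 4) K))
    (f₂ := RingHom.id _) (p₁ := ψ) (p₂ := ψ) (by ext c; simp [tsch]) (fun i hi _ => by
      have hif : i ≠ f := fun h => hψ (h ▸ hi)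
      rw [RingHom.coe_coe, tsch_X_of_ne φ hif, RingHom.id_apply]) rfl
  simpa using h

/-- **Group law**: `tsch f φ ∘ tsch f ψ = tsch f (ψ + φ)` when `ψ` does not involve `x_f`. [folklore] -/
theorem tsch_comp_tsch (φ : MvPolynomial (Fin 4) K) {ψ : MvPolynomial (Fin 4) K} (hψ : f ∉ ψ.vars) :
    (tsch f φ).comp (tsch f ψ) = tsch f (ψ + φ) := by
  refine MvPolynomial.algHom_ext fun i => ?_
  by_cases h : i = f
  · subst h
    rw [AlgHom.comp_apply, tsch_X_self, map_add, tsch_X_self, tsch_apply_of_not_mem_vars φ hψ, tsch_X_self]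
    ring
  · rw [AlgHom.comp_apply, tsch_X_of_ne _ h, tsch_X_of_ne _ h, tsch_X_of_ne _ h]

/-- `tsch f 0 = id`. [folklore] -/
theorem tsch_zero (f : Fin 4) : tsch f (0 : MvPolynomial (Fin 4) K) = AlgHom.id K _ := by
  refine MvPolynomial.algHom_ext fun i => ?_
  by_cases h : i = f
  · subst h; rw [tsch_X_self, add_zero, AlgHom.id_apply]
  · rw [tsch_X_of_ne _ h, AlgHom.id_apply]

/-- `tsch f φ ∘ tsch f (−φ) = id` (`f ∉ φ.vars`). [folklore] -/
theorem tsch_comp_tsch_neg (hφ : f ∉ φ.vars) : (tsch f φ).comp (tsch f (-φ)) = AlgHom.id K _ := by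
  rw [tsch_comp_tsch φ (by rwa [MvPolynomial.vars_neg]), neg_add_cancel, tsch_zero]

/-- `tsch f (−φ) ∘ tsch f φ = id` (`f ∉ φ.vars`). [folklore] -/
theorem tsch_neg_comp_tsch (hφ : f ∉ φ.vars) : (tsch f (-φ)).comp (tsch f φ) = AlgHom.id K _ := by
  rw [tsch_comp_tsch (-φ) hφ, add_neg_cancel, tsch_zero]

/-- `tsch f (−φ) (tsch f φ F) = F`. [folklore] -/
theorem tsch_neg_tsch (hφ : f ∉ φ.vars) (F : MvPolynomial (Fin 4) K) : tsch f (-φ) (tsch f φ F) = F := by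
  rw [← AlgHom.comp_apply, tsch_neg_comp_tsch hφ, AlgHom.id_apply]

/-- **The move as a `K`-algebra automorphism** of `K[x₁..x₄]`, inverse `tsch f (−φ)`. [folklore] -/
def tschEquiv (f : Fin 4) (φ : MvPolynomial (Fin 4) K) (hφ : f ∉ φ.vars) :
    MvPolynomial (Fin 4) K ≃ₐ[K] MvPolynomial (Fin 4) K :=
  AlgEquiv.ofAlgHom (tsch f φ) (tsch f (-φ)) (tsch_comp_tsch_neg hφ) (tsch_neg_comp_tsch hφ)

/-- `tschEquiv` acts as `tsch`. [folklore] -/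
@[simp] theorem tschEquiv_apply (hφ : f ∉ φ.vars) (F : MvPolynomial (Fin 4) K) :
    tschEquiv f φ hφ F = tsch f φ F := rfl

/-- The inverse of `tschEquiv` is `tsch f (−φ)`. [folklore] -/
theorem tschEquiv_symm_apply (hφ : f ∉ φ.vars) (F : MvPolynomial (Fin 4) K) :
    (tschEquiv f φ hφ).symm F = tsch f (-φ) F := rfl

/-- **Boundary monomials are fixed**: `tsch f φ (c·x^r) = c·x^r` when `r_f = 0` (the move touches a FREE
letter only, so `F = x^r · G` keeps its boundary factor). [folklore] -/
theorem tsch_monomial_of_apply_eq_zero (φ : MvPolynomial (Fin 4) K) {r : Fin 4 →₀ ℕ} (hr : r f = 0) (c : K) :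
    tsch f φ (monomial r c) = monomial r c := by
  refine tsch_apply_of_not_mem_vars φ ((not_mem_vars_iff f _).mpr fun d hd => ?_)
  classical
  rw [Finset.mem_singleton.mp (support_monomial_subset hd), hr]

/-- `tsch` passes a boundary factor: `tsch f φ (x^r · G) = x^r · tsch f φ G` (`r_f = 0`). [folklore] -/
theorem tsch_monomial_mul (φ : MvPolynomial (Fin 4) K) {r : Fin 4 →₀ ℕ} (hr : r f = 0)
    (G : MvPolynomial (Fin 4) K) : tsch f φ (monomial r 1 * G) = monomial r 1 * tsch f φ G := by
  rw [map_mul, tsch_monomial_of_apply_eq_zero φ hr]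

/-! ## 2. Constant term and order -/

/-- The move fixes the origin when `φ(0) = 0`. [folklore] -/
theorem constantCoeff_tsch_X (h0 : constantCoeff φ = 0) (i : Fin 4) : constantCoeff (tsch f φ (X i)) = 0 := by
  by_cases h : i = f
  · subst h; rw [tsch_X_self, map_add, constantCoeff_X, h0, add_zero]
  · rw [tsch_X_of_ne _ h, constantCoeff_X]

/-- The move does not change constant terms (`φ(0) = 0`). [folklore] -/
theorem constantCoeff_tsch (h0 : constantCoeff φ = 0) (F : MvPolynomial (Fin 4) K) :
    constantCoeff (tsch f φ F) = constantCoeff F := by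
  have h : (constantCoeff : MvPolynomial (Fin 4) K →+* K).comp (tsch f φ : MvPolynomial (Fin 4) K →+* _) =
      (constantCoeff : MvPolynomial (Fin 4) K →+* K) := by
    refine MvPolynomial.ringHom_ext (fun c => ?_) (fun i => ?_)
    · simp [tsch]
    · rw [RingHom.comp_apply, RingHom.coe_coe, constantCoeff_tsch_X h0, constantCoeff_X]
  exact RingHom.congr_fun h F

/-- The move does not lower `ord₀` (`φ(0) = 0`). [folklore] -/
theorem ordZero_le_ordZero_tsch (h0 : constantCoeff φ = 0) (F : MvPolynomial (Fin 4) K) :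
    ordZero F ≤ ordZero (tsch f φ F) := by
  rw [tsch_eq_aeval]
  exact le_ordZero_aeval _ (constantCoeff_tsch_X h0) F

/-- **`ord₀` is preserved** by the move (`φ(0) = 0`, `f ∉ φ.vars`). [folklore] -/
theorem ordZero_tsch (hφ : f ∉ φ.vars) (h0 : constantCoeff φ = 0) (F : MvPolynomial (Fin 4) K) :
    ordZero (tsch f φ F) = ordZero F := by
  refine le_antisymm ?_ (ordZero_le_ordZero_tsch h0 F)
  have h := ordZero_le_ordZero_tsch (f := f) (φ := -φ) (by rw [map_neg, h0, neg_zero]) (tsch f φ F)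
  rwa [tsch_neg_tsch hφ] at h

/-! ## 3. The dictionary with the point blow-up (chart `j ≠ f`) -/

section Chart

variable {j : Fin 4}

/-- `φ(0) = 0` means `1 ≤ ord_{univ} φ`. [folklore] -/
theorem one_le_ordAlong_univ (h0 : constantCoeff φ = 0) :
    ((1 : ℕ) : ℕ∞) ≤ ordAlong (Finset.univ : Finset (Fin 4)) φ := by
  rw [ordAlong_univ, Nat.cast_one]
  exact (one_le_ordZero_iff φ).mpr h0

/-- **`σ_j(φ) = x_j · φ′`** with `φ′ := chartTransform 1 univ j φ` (the controlled transform of `φ` with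
control `1`), for `φ(0) = 0`. [cite: HauserPerlega2019PRIMS, §2 (the blowup in the x₁-chart)] -/
theorem coordBlowupSubst_eq_X_mul_chartTransform_one (j : Fin 4) (h0 : constantCoeff φ = 0) :
    coordBlowupSubst K (Set.univ : Set (Fin 4)) j φ = X j * chartTransform 1 Finset.univ j φ := by
  classical
  have h := ChartDictionary.coordBlowupSubst_eq_X_pow_mul_chartTransform (K := K) (Finset.mem_univ j) 1 φ
    (one_le_ordAlong_univ h0)
  rwa [Finset.coe_univ, pow_one] at h

/-- `φ′` does not involve `x_f` if `φ` does not (`j ≠ f`): the chart law only changes the `x_j`-exponent.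
[folklore] -/
theorem not_mem_vars_chartTransform (q : ℕ) (S : Finset (Fin 4)) (hjf : j ≠ f) (hφ : f ∉ φ.vars) :
    f ∉ (chartTransform q S j φ).vars := by
  classical
  rw [not_mem_vars_iff] at hφ ⊢
  intro e he
  unfold chartTransform at he
  obtain ⟨d, hd, hde⟩ := Finset.mem_biUnion.mp (MvPolynomial.support_sum he)
  have he' : e = chartExponent q S j d := Finset.mem_singleton.mp (support_monomial_subset hde)
  subst he'
  rw [chartExponent, Finsupp.update_apply, if_neg (Ne.symm hjf)]
  exact hφ d hd

/-- **The move passes the chart substitution**: `σ_j ∘ tsch f φ = tsch f φ′ ∘ σ_j` as `K`-algebra maps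
(`j ≠ f`, `φ(0) = 0`), `φ′ = chartTransform 1 univ j φ`. [folklore] -/
theorem coordBlowupSubst_comp_tsch (hjf : j ≠ f) (h0 : constantCoeff φ = 0) :
    (coordBlowupSubst K (Set.univ : Set (Fin 4)) j).comp (tsch f φ) =
      (tsch f (chartTransform 1 Finset.univ j φ)).comp (coordBlowupSubst K (Set.univ : Set (Fin 4)) j) := by
  refine MvPolynomial.algHom_ext fun i => ?_
  rw [AlgHom.comp_apply, AlgHom.comp_apply]
  by_cases hif : i = f
  · subst hif
    rw [tsch_X_self, map_add, coordBlowupSubst_X_of_mem_of_ne K _ j (Set.mem_univ _) hjf.symm,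
      coordBlowupSubst_eq_X_mul_chartTransform_one j h0, map_mul, tsch_X_of_ne _ hjf, tsch_X_self]
    ring
  · rw [tsch_X_of_ne _ hif]
    by_cases hij : i = j
    · subst hij
      rw [coordBlowupSubst_X_self, tsch_X_of_ne _ hif]
    · rw [coordBlowupSubst_X_of_mem_of_ne K _ j (Set.mem_univ _) hij, map_mul, tsch_X_of_ne _ hjf,
        tsch_X_of_ne _ hif]

/-- **The move passes the chart transform**: for `q ≤ ord₀ F`, `j ≠ f`, `φ(0) = 0`,
`chartTransform q univ j (tsch f φ F) = tsch f φ′ (chartTransform q univ j F)`.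
[cite: HauserPerlega2019PRIMS, §2 (the blowup in the x₁-chart)] [folklore] -/
theorem chartTransform_tsch {q : ℕ} {F : MvPolynomial (Fin 4) K} (hq : (q : ℕ∞) ≤ ordZero F) (hjf : j ≠ f)
    (h0 : constantCoeff φ = 0) :
    chartTransform q Finset.univ j (tsch f φ F) =
      tsch f (chartTransform 1 Finset.univ j φ) (chartTransform q Finset.univ j F) := by
  classical
  have hq1 : (q : ℕ∞) ≤ ordAlong Finset.univ F := by rwa [ordAlong_univ]
  have hq2 : (q : ℕ∞) ≤ ordAlong Finset.univ (tsch f φ F) := by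
    rw [ordAlong_univ]; exact hq.trans (ordZero_le_ordZero_tsch h0 F)
  have h1 := ChartDictionary.coordBlowupSubst_eq_X_pow_mul_chartTransform (K := K) (Finset.mem_univ j) q F hq1
  have h2 := ChartDictionary.coordBlowupSubst_eq_X_pow_mul_chartTransform (K := K) (Finset.mem_univ j) q _ hq2
  rw [Finset.coe_univ] at h1 h2
  have hcomp := congrArg (fun L : MvPolynomial (Fin 4) K →ₐ[K] MvPolynomial (Fin 4) K => L F)
    (coordBlowupSubst_comp_tsch (K := K) hjf h0)
  simp only [AlgHom.comp_apply] at hcomp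
  rw [h2, h1, map_mul, map_pow, tsch_X_of_ne _ hjf] at hcomp
  exact mul_left_cancel₀ (pow_ne_zero _ (X_ne_zero j)) hcomp

/-- **The move passes a translation**: `translate b (tsch f ψ G) = tsch f (translate b ψ) (translate b G)`.
[folklore] -/
theorem translate_tsch (b : Fin 4 → K) (ψ G : MvPolynomial (Fin 4) K) :
    translate b (tsch f ψ G) = tsch f (translate b ψ) (translate b G) := by
  have key : (aeval fun i => (X i + C (b i) : MvPolynomial (Fin 4) K)).comp (tsch f ψ) =
      (tsch f (translate b ψ)).comp (aeval fun i => (X i + C (b i) : MvPolynomial (Fin 4) K)) := by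
    refine MvPolynomial.algHom_ext fun i => ?_
    rw [AlgHom.comp_apply, AlgHom.comp_apply, aeval_X]
    by_cases h : i = f
    · subst h
      rw [tsch_X_self, map_add, aeval_X, map_add, tsch_X_self, MvPolynomial.algHom_C, algebraMap_eq]
      unfold PointBlowup.translate
      ring
    · rw [tsch_X_of_ne _ h, aeval_X, map_add, tsch_X_of_ne _ h, MvPolynomial.algHom_C, algebraMap_eq]
  have h := congrArg (fun L : MvPolynomial (Fin 4) K →ₐ[K] MvPolynomial (Fin 4) K => L G) key
  simp only [AlgHom.comp_apply] at h
  exact h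

/-- Moving a constant of the datum into the translation: `tsch f (ψ − c) ∘ translate (c·e_f) = tsch f ψ`.
[folklore] -/
theorem tsch_sub_C_translate_single (c : K) (ψ G : MvPolynomial (Fin 4) K) :
    tsch f (ψ - C c) (translate (Pi.single f c) G) = tsch f ψ G := by
  have key : (tsch f (ψ - C c)).comp (aeval fun i => (X i + C (Pi.single f c i) : MvPolynomial (Fin 4) K)) =
      tsch f ψ := by
    refine MvPolynomial.algHom_ext fun i => ?_
    rw [AlgHom.comp_apply, aeval_X, map_add, MvPolynomial.algHom_C, algebraMap_eq]
    by_cases h : i = f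
    · subst h
      rw [tsch_X_self, tsch_X_self, Pi.single_eq_same]
      ring
    · rw [tsch_X_of_ne _ h, tsch_X_of_ne _ h, Pi.single_eq_of_ne h, C_0, add_zero]
  have h := congrArg (fun L : MvPolynomial (Fin 4) K →ₐ[K] MvPolynomial (Fin 4) K => L G) key
  simp only [AlgHom.comp_apply] at h
  exact h

/-- `b⁺ = b + (eval b φ′)·e_f`. [folklore] -/
theorem update_eq_single_add (b : Fin 4 → K) (c : K) :
    Function.update b f (b f + c) = Pi.single f c + b := by
  funext i
  by_cases h : i = f
  · subst h; rw [Function.update_self, Pi.add_apply, Pi.single_eq_same, add_comm]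
  · rw [Function.update_of_ne h, Pi.add_apply, Pi.single_eq_of_ne h, zero_add]

/-- **THE DICTIONARY**: for `q ≤ ord₀ F`, chart `j ≠ f`, `φ(0) = 0`, and any translation `b`,
`pointTransform q univ j b ⟨tsch f φ F, r, exc⟩ = tsch f φ⁺ (pointTransform q univ j b⁺ ⟨F, r, exc⟩)` with
`φ′ = chartTransform 1 univ j φ`, `b⁺ = update b f (b f + eval b φ′)`, `φ⁺ = translate b φ′ − C (eval b φ′)`:
the re-coordinatised state's transform at `b` is the re-coordinatised transform at `b⁺` — the translation
moves along the contact letter `f` only, by the value of `φ′` at `b`. [cite: Hauser2010, §F (chart expressions of a point blowup)] [folklore] -/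
theorem pointTransform_tsch {q : ℕ} {s : State K} (hq : (q : ℕ∞) ≤ ordZero s.F) (hjf : j ≠ f)
    (h0 : constantCoeff φ = 0) (b : Fin 4 → K) :
    pointTransform q Finset.univ j b ⟨tsch f φ s.F, s.r, s.exc⟩ =
      tsch f (translate b (chartTransform 1 Finset.univ j φ) -
          C (MvPolynomial.eval b (chartTransform 1 Finset.univ j φ)))
        (pointTransform q Finset.univ j
          (Function.update b f (b f + MvPolynomial.eval b (chartTransform 1 Finset.univ j φ))) s) := by
  set φ' := chartTransform 1 Finset.univ j φ with hφ'
  change translate b (chartTransform q Finset.univ j (tsch f φ s.F)) =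
    tsch f (translate b φ' - C (MvPolynomial.eval b φ')) (translate _ (chartTransform q Finset.univ j s.F))
  rw [chartTransform_tsch hq hjf h0, translate_tsch, update_eq_single_add, ← MohAlong.translate_translate,
    tsch_sub_C_translate_single]

end Chart


end FrameChange

end Summit.ResolutionOfSingularities.ResolutionOfSingularities.Theorems.PIDim4

end
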